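import Literature.Topology.FourManifolds.NonSeparatingSpheresCover
import HarnessLib

/-!
# Descent of deck-equivariant diffeomorphisms of the cylinder `ℝ × Y` to `S¹ × Y`

Infrastructure for the fact seat of
`Literature.Topology.FourManifolds.BudneyGabai2019_thm_3_13` (`NonSeparatingSpheres.lean`;
R. Budney, D. Gabai, *Knotted 3-balls in `S⁴`*, arXiv:1912.09029, Thm. 3.13: `Diff(S¹ × Sⁿ)` acts
transitively on the non-separating `n`-spheres of `S¹ × Sⁿ`).  The classical argument for
`n ≤ 2` straightens the *lift* `K̃ ⊆ ℝ × Sⁿ` of a non-separating sphere `K` by a diffeomorphism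
`H` of the cyclic cover `ℝ × Sⁿ` commuting with the deck transformation
`τ (t, y) = (t + 2π, y)`; such an `H` is the lift of a diffeomorphism `Φ` of `S¹ × Sⁿ`, and
`Φ` then carries the standard sphere `{1} × Sⁿ = π({0} × Sⁿ)` onto `K = π(K̃)`.  This file proves
the descent step, for the covering `π = exp × id : ℝ × Y → S¹ × Y` over an arbitrary charted
space `Y` (Hatcher, *Algebraic Topology*, §1.3: maps between covering spaces commuting with the
deck group descend to the quotients; smoothness is local because `π` has smooth local sections,
the angle functions of `NonSeparatingSpheresCover.lean`):

* `Cylinder.apply_deck_int` — a self-map of `ℝ × Y` commuting with `τ` commutes with all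
  `τᵐ`, `m ∈ ℤ`;
* `Cylinder.exists_descend` — **a `C^∞` map `H : ℝ × Y → ℝ × Y` with `H ∘ τ = τ ∘ H` descends**:
  there is a `C^∞` map `Φ : S¹ × Y → S¹ × Y` with `Φ ∘ π = π ∘ H`;
* `Cylinder.exists_diffeomorph_descend` — **a `τ`-equivariant diffeomorphism `H` of `ℝ × Y`
  descends to a diffeomorphism `Φ` of `S¹ × Y`** with `Φ ∘ π = π ∘ H`; consequently
  `Φ '' (π '' A) = π '' (H '' A)` for every `A ⊆ ℝ × Y` (`image_descend`).

Everything here is proved; no definition and no named fact is introduced.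

## References

* A. Hatcher, *Algebraic Topology*, CUP (2002), §1.3 (deck transformations, lifting and
  descending maps). [HatcherAT2002]
* R. Budney, D. Gabai, *Knotted 3-balls in `S⁴`*, arXiv:1912.09029 (v2), §3, Thm. 3.13.
  [BudneyGabai2019]
-/

noncomputable section

open scoped Manifold ContDiff Topology Real
open Set Function Metric

namespace Literature.Topology.FourManifolds

namespace Cylinder

section Deck

variable {Y : Type*}

/-- The covering map `exp × id` is invariant under the deck transformations
`(t, y) ↦ (t + 2πm, y)`, `m ∈ ℤ`. [folklore] -/
theorem prodMap_exp_deck (m : ℤ) (q : ℝ × Y) :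
    (Prod.map Circle.exp id ((q.1 + m * (2 * π), q.2) : ℝ × Y) : Circle × Y) =
      Prod.map Circle.exp id q := by
  obtain ⟨t, y⟩ := q
  simp only [Prod.map_apply, id_eq, Prod.mk.injEq, and_true]
  exact Circle.exp_eq_exp.2 ⟨m, rfl⟩

/-- A `τ`-equivariant self-map of the cylinder is `τⁿ`-equivariant for all `n ∈ ℕ`.
[folklore] -/
theorem apply_deck_nat {F : ℝ × Y → ℝ × Y}
    (hF : ∀ q : ℝ × Y, F (q.1 + 2 * π, q.2) = ((F q).1 + 2 * π, (F q).2)) (m : ℕ)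
    (q : ℝ × Y) : F (q.1 + m * (2 * π), q.2) = ((F q).1 + m * (2 * π), (F q).2) := by
  induction m generalizing q with
  | zero => simp
  | succ k ih =>
    have h1 : q.1 + ((k + 1 : ℕ) : ℝ) * (2 * π) = (q.1 + k * (2 * π)) + 2 * π := by
      push_cast; ring
    have h2 := hF (q.1 + k * (2 * π), q.2)
    simp only at h2
    rw [h1, h2, ih q]
    ext
    · push_cast
      ring
    · rfl

/-- **A `τ`-equivariant self-map of the cylinder is `τᵐ`-equivariant for all `m ∈ ℤ`**: if
`F (t + 2π, y) = τ (F (t, y))` for all `(t, y)` then `F (t + 2πm, y) = τᵐ (F (t, y))`.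
[folklore] -/
theorem apply_deck_int {F : ℝ × Y → ℝ × Y}
    (hF : ∀ q : ℝ × Y, F (q.1 + 2 * π, q.2) = ((F q).1 + 2 * π, (F q).2)) (m : ℤ)
    (q : ℝ × Y) : F (q.1 + m * (2 * π), q.2) = ((F q).1 + m * (2 * π), (F q).2) := by
  obtain ⟨k, rfl | rfl⟩ := Int.eq_nat_or_neg m
  · exact_mod_cast apply_deck_nat hF k q
  · -- apply the natural-number case at the shifted point `q' = (t - 2πk, y)`
    have h1 := apply_deck_nat hF k (q.1 + (-(k : ℤ) : ℤ) * (2 * π), q.2)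
    simp only at h1
    have h2 : q.1 + (-(k : ℤ) : ℤ) * (2 * π) + k * (2 * π) = q.1 := by push_cast; ring
    rw [h2] at h1
    -- `h1 : F q = ((F q').1 + k 2π, (F q').2)`
    have h3 := congrArg Prod.fst h1
    have h4 := congrArg Prod.snd h1
    simp only at h3 h4
    ext
    · simp only
      push_cast at h3 ⊢
      linarith
    · exact h4.symm

/-- If `F` commutes with the deck transformation then `π ∘ F` is constant on the fibres of
`π = exp × id`: `π (F (t', y)) = π (F (t, y))` whenever `e^{it'} = e^{it}`. [folklore] -/
theorem prodMap_exp_apply_eq_of_exp_eq {F : ℝ × Y → ℝ × Y}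
    (hF : ∀ q : ℝ × Y, F (q.1 + 2 * π, q.2) = ((F q).1 + 2 * π, (F q).2)) {t t' : ℝ}
    (h : Circle.exp t' = Circle.exp t) (y : Y) :
    (Prod.map Circle.exp id (F (t', y)) : Circle × Y) = Prod.map Circle.exp id (F (t, y)) := by
  obtain ⟨m, hm⟩ := Circle.exp_eq_exp.1 h
  have h1 := apply_deck_int hF m (t, y)
  simp only at h1
  rw [hm, h1]
  exact prodMap_exp_deck m (F (t, y))

/-- Under `Φ ∘ π = π ∘ H`, images correspond: `Φ (π A) = π (H A)`. [folklore] -/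
theorem image_descend {Φ : Circle × Y → Circle × Y} {H : ℝ × Y → ℝ × Y}
    (hΦ : ∀ q : ℝ × Y, Φ (Prod.map Circle.exp id q) = Prod.map Circle.exp id (H q))
    (A : Set (ℝ × Y)) :
    Φ '' (Prod.map Circle.exp id '' A) = Prod.map Circle.exp id '' (H '' A) := by
  rw [image_image, image_image]
  exact image_congr fun q _ ↦ hΦ q

end Deck

section Smooth

variable {E H : Type*} [NormedAddCommGroup E] [NormedSpace ℝ E] [TopologicalSpace H]
  {I : ModelWithCorners ℝ E H} {Y : Type*} [TopologicalSpace Y] [ChartedSpace H Y]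

/-- The covering map `exp × id : ℝ × Y → S¹ × Y` is `C^∞`. [folklore] -/
theorem contMDiff_prodMap_exp :
    ContMDiff (𝓘(ℝ, ℝ).prod I) ((𝓡 1).prod I) ∞
      (Prod.map Circle.exp id : ℝ × Y → Circle × Y) :=
  contMDiff_circleExp.prodMap contMDiff_id

/-- **Descent of equivariant smooth maps.**  A `C^∞` map `F : ℝ × Y → ℝ × Y` commuting with the
deck transformation `τ (t, y) = (t + 2π, y)` descends to a `C^∞` map `Φ : S¹ × Y → S¹ × Y` with
`Φ ∘ π = π ∘ F`, `π = exp × id` (define `Φ (z, y) = π (F (arg z, y))`; near any point replace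
`arg` by an angle function smooth there — the value does not change because `π ∘ F` is constant on
fibres). [cite: HatcherAT2002, §1.3] -/
theorem exists_descend {F : ℝ × Y → ℝ × Y}
    (hFs : ContMDiff (𝓘(ℝ, ℝ).prod I) (𝓘(ℝ, ℝ).prod I) ∞ F)
    (hF : ∀ q : ℝ × Y, F (q.1 + 2 * π, q.2) = ((F q).1 + 2 * π, (F q).2)) :
    ∃ Φ : Circle × Y → Circle × Y, ContMDiff ((𝓡 1).prod I) ((𝓡 1).prod I) ∞ Φ ∧
      ∀ q : ℝ × Y, Φ (Prod.map Circle.exp id q) = Prod.map Circle.exp id (F q) := by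
  refine ⟨fun p ↦ Prod.map Circle.exp id (F (Complex.arg (p.1 : ℂ), p.2)), fun p ↦ ?_,
    fun q ↦ ?_⟩
  · -- smoothness at `p`: use an angle function smooth at `p.1`
    obtain ⟨A, hA, hAexp⟩ := CircleExpLift.exists_angle_contMDiffAt p.1
    have heq : (fun p : Circle × Y ↦
        (Prod.map Circle.exp id (F (Complex.arg (p.1 : ℂ), p.2)) : Circle × Y)) =
        fun p ↦ Prod.map Circle.exp id (F (A p.1, p.2)) := by
      funext p'
      apply prodMap_exp_apply_eq_of_exp_eq hF
      rw [Circle.exp_arg, hAexp]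
    rw [heq]
    have h1 : ContMDiffAt ((𝓡 1).prod I) (𝓘(ℝ, ℝ).prod I) ∞
        (fun p : Circle × Y ↦ ((A p.1, p.2) : ℝ × Y)) p :=
      (hA.comp p contMDiffAt_fst).prodMk contMDiffAt_snd
    exact contMDiff_prodMap_exp.contMDiffAt.comp p ((hFs.contMDiffAt).comp p h1)
  · obtain ⟨t, y⟩ := q
    show Prod.map Circle.exp id (F (Complex.arg (Circle.exp t : ℂ), y)) =
      Prod.map Circle.exp id (F (t, y))
    exact prodMap_exp_apply_eq_of_exp_eq hF (Circle.exp_arg _) y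

/-- **Descent of equivariant diffeomorphisms.**  A diffeomorphism `H` of the cylinder `ℝ × Y`
commuting with the deck transformation `τ (t, y) = (t + 2π, y)` descends to a diffeomorphism
`Φ` of `S¹ × Y` with `Φ ∘ π = π ∘ H`, `π = exp × id`: descend `H` and `H⁻¹` (which is
equivariant as well) by `exists_descend`; the two descended maps are mutually inverse because
`π` is onto. [cite: HatcherAT2002, §1.3] -/
theorem exists_diffeomorph_descend
    (H : (ℝ × Y) ≃ₘ⟮𝓘(ℝ, ℝ).prod I, 𝓘(ℝ, ℝ).prod I⟯ (ℝ × Y))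
    (hH : ∀ q : ℝ × Y, H (q.1 + 2 * π, q.2) = ((H q).1 + 2 * π, (H q).2)) :
    ∃ Φ : (Circle × Y) ≃ₘ⟮(𝓡 1).prod I, (𝓡 1).prod I⟯ (Circle × Y),
      ∀ q : ℝ × Y, Φ (Prod.map Circle.exp id q) = Prod.map Circle.exp id (H q) := by
  -- `H⁻¹` is equivariant as well
  have hH' : ∀ q : ℝ × Y, H.symm (q.1 + 2 * π, q.2) = ((H.symm q).1 + 2 * π, (H.symm q).2) := by
    intro q
    have h1 := hH (H.symm q)
    rw [H.apply_symm_apply] at h1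
    have h2 := congrArg H.symm h1
    rw [H.symm_apply_apply] at h2
    exact h2.symm
  obtain ⟨Φ, hΦs, hΦ⟩ := exists_descend H.contMDiff hH
  obtain ⟨Ψ, hΨs, hΨ⟩ := exists_descend H.symm.contMDiff hH'
  -- `π` is onto
  have hsurj : Surjective (Prod.map Circle.exp id : ℝ × Y → Circle × Y) := fun p ↦
    ⟨(Complex.arg (p.1 : ℂ), p.2), by simp [Circle.exp_arg]⟩
  have hleft : LeftInverse Ψ Φ := fun p ↦ by
    obtain ⟨q, rfl⟩ := hsurj p
    rw [hΦ, hΨ, H.symm_apply_apply]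
  have hright : RightInverse Ψ Φ := fun p ↦ by
    obtain ⟨q, rfl⟩ := hsurj p
    rw [hΨ, hΦ, H.apply_symm_apply]
  let e : (Circle × Y) ≃ (Circle × Y) := ⟨Φ, Ψ, hleft, hright⟩
  exact ⟨⟨e, hΦs, hΨs⟩, hΦ⟩

end Smooth

end Cylinder

end Literature.Topology.FourManifolds

end
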